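import Summits.HubbardSuperconductivity.HubbardSuperconductivity.Theorems.AnisotropyChordTransferFibre3Resolvent

/-!
# Route `AnisotropyChord` / H0 rotor rung: PORT N30-A — equivariance of the pole projection and of the pole-removed resolvent

Infrastructure for the backward half of THEOREM KREIN-3 (memo ROTOR-THEORY-20 §278; fixed point ⇒ symmetric eigenfunction
`Ψ = v + G_T ρ`) and for the Krein–JF identity: the pole projection `Π` and the pole-removed resolvent `G_T` commute with the
two generators of the twisted `S₃` action (`swap23`, `U12`), `G_T` is characterised by `(H₀ − E)G_T F = F − ΠF`, `Π G_T F = 0`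
(`eq_zero_of_H0E_of_PiPole`: a function killed by `H₀ − E` and by `Π` vanishes), and `Π ∘ G_T = 0`.
Prover seat `hubbard-h0-rotor-p1` g21; helper for stmt-HubbardSuperconductivity-19089 (`--supports`).
-/

set_option linter.dupNamespace false
set_option autoImplicit false

noncomputable section

open scoped BigOperators
open Complex

namespace Summit.HubbardSuperconductivity.HubbardSuperconductivity.Theorems.AnisotropyChord.Transfer.Fibre3

variable (L : ℕ) [NeZero L]

/-! ## Linearity helpers -/

/-- [folklore] -/
theorem ip_sub_right (A F G : Cfg L → ℂ) : ip L A (fun c => F c - G c) = ip L A F - ip L A G := by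
  unfold ip; rw [← Finset.sum_sub_distrib]; refine Finset.sum_congr rfl fun c _ => ?_; ring

omit [NeZero L] in
/-- [folklore] -/
theorem H0apply_sub (K : Tor L) (F G : Cfg L → ℂ) (c : Cfg L) :
    H0apply L K (fun d => F d - G d) c = H0apply L K F c - H0apply L K G c := by
  simp only [H0apply_four, hopT]; ring

/-- [folklore] -/
theorem PiPole_sub (F G : Cfg L → ℂ) (c : Cfg L) :
    PiPole L (fun d => F d - G d) c = PiPole L F c - PiPole L G c := by
  unfold PiPole
  rw [← mul_sub, ← Finset.sum_sub_distrib]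
  congr 1
  refine Finset.sum_congr rfl fun k _ => ?_
  split_ifs
  · rw [ip_sub_right]; ring
  · simp

/-- [folklore] -/
theorem Gapply_zero_fun (T : ℝ) (c : Cfg L) : Gapply L T (fun _ => (0 : ℂ)) c = 0 := by
  unfold Gapply; simp

/-! ## Uniqueness for the pole-removed resolvent -/

/-- **a function annihilated by `H₀ − E` and by the pole projection vanishes** (`T < 2ε₁`, `L ≥ 4`). [folklore] -/
theorem eq_zero_of_H0E_of_PiPole (hL : 4 ≤ L) {T : ℝ} (hT : T < 2 * eps1 L) (h : Cfg L → ℂ)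
    (hH : ∀ c, H0apply L (K1 L) h c - ((eps1 L + T : ℝ) : ℂ) * h c = 0) (hP : ∀ c, PiPole L h c = 0) (c : Cfg L) :
    h c = 0 := by
  have key := Gapply_H0E L hL hT h c
  rw [hP c, sub_zero] at key
  rw [← key]
  have e : (fun d => H0apply L (K1 L) h d - ((eps1 L + T : ℝ) : ℂ) * h d) = fun _ => (0 : ℂ) := funext hH
  rw [e, Gapply_zero_fun]

/-- Fourier coefficients of `G_T F`: `⟨pw_k, G_T F⟩ = gcoef_k`. [folklore] -/
theorem ip_pw_Gapply (T : ℝ) (F : Cfg L → ℂ) (k : Tor L × Tor L) :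
    ip L (pw L k.1 k.2) (Gapply L T F) = gcoef L T F k := by
  classical
  have hV : ((L : ℂ) ^ 2) ^ 2 ≠ 0 := by
    have : (L : ℂ) ≠ 0 := by exact_mod_cast (NeZero.ne L)
    positivity
  unfold ip
  simp_rw [Gapply_eq]
  calc ∑ c : Cfg L, (starRingEnd ℂ) (pw L k.1 k.2 c) * ((1 / ((L : ℂ) ^ 2) ^ 2)
          * ∑ k' : Tor L × Tor L, gcoef L T F k' * pw L k'.1 k'.2 c)
      = ∑ c : Cfg L, ∑ k' : Tor L × Tor L, (1 / ((L : ℂ) ^ 2) ^ 2) * (gcoef L T F k'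
          * ((starRingEnd ℂ) (pw L k.1 k.2 c) * pw L k'.1 k'.2 c)) := by
        refine Finset.sum_congr rfl fun c _ => ?_
        rw [Finset.mul_sum, Finset.mul_sum]
        refine Finset.sum_congr rfl fun k' _ => ?_; ring
    _ = ∑ k' : Tor L × Tor L, ∑ c : Cfg L, (1 / ((L : ℂ) ^ 2) ^ 2) * (gcoef L T F k'
          * ((starRingEnd ℂ) (pw L k.1 k.2 c) * pw L k'.1 k'.2 c)) := Finset.sum_comm
    _ = ∑ k' : Tor L × Tor L, (1 / ((L : ℂ) ^ 2) ^ 2) * (gcoef L T F k' * ip L (pw L k.1 k.2) (pw L k'.1 k'.2)) := by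
        refine Finset.sum_congr rfl fun k' _ => ?_
        unfold ip; rw [Finset.mul_sum, Finset.mul_sum]
    _ = gcoef L T F k := by
        simp_rw [ip_pw_pw]
        simp only [mul_ite, mul_zero]
        rw [Finset.sum_ite_eq Finset.univ k]
        simp only [Finset.mem_univ, if_true]
        rw [mul_comm (gcoef L T F k), ← mul_assoc, one_div_mul_cancel hV, one_mul]

/-- **`Π ∘ G_T = 0`.** [folklore] -/
theorem PiPole_Gapply (hL : 2 ≤ L) (T : ℝ) (F : Cfg L → ℂ) (c : Cfg L) : PiPole L (Gapply L T F) c = 0 := by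
  have p0 : IsPoleK1 L 0 0 = true := (isPoleK1_iff L (0, 0)).2 (Or.inl rfl)
  have p1 : IsPoleK1 L (K1 L) 0 = true := (isPoleK1_iff L (K1 L, 0)).2 (Or.inr (Or.inl rfl))
  have p2 : IsPoleK1 L 0 (K1 L) = true := (isPoleK1_iff L (0, K1 L)).2 (Or.inr (Or.inr rfl))
  rw [PiPole_eq L hL]
  rw [show pw L 0 0 = pw L ((0, 0) : Tor L × Tor L).1 ((0, 0) : Tor L × Tor L).2 from rfl, ip_pw_Gapply,
    show pw L (K1 L) 0 = pw L ((K1 L, 0) : Tor L × Tor L).1 ((K1 L, 0) : Tor L × Tor L).2 from rfl, ip_pw_Gapply,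
    show pw L 0 (K1 L) = pw L ((0, K1 L) : Tor L × Tor L).1 ((0, K1 L) : Tor L × Tor L).2 from rfl, ip_pw_Gapply]
  unfold gcoef
  simp [p0, p1, p2]

/-! ## `swap23` -/

/-- `⟨pw_{k₂k₃}, swap F⟩ = ⟨pw_{k₃k₂}, F⟩`. [folklore] -/
theorem ip_pw_swap23 (k₂ k₃ : Tor L) (F : Cfg L → ℂ) : ip L (pw L k₂ k₃) (swap23 L F) = ip L (pw L k₃ k₂) F := by
  unfold ip swap23 pw
  rw [← Equiv.sum_comp (Equiv.prodComm (Tor L) (Tor L))]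
  refine Finset.sum_congr rfl fun c _ => ?_
  simp only [Equiv.prodComm_apply, Prod.fst_swap, Prod.snd_swap]
  rw [show F (c.1, c.2) = F c from rfl, mul_comm (phase L k₂ c.2)]

/-- **`Π` commutes with `swap23`.** [folklore] -/
theorem PiPole_swap23 (hL : 2 ≤ L) (F : Cfg L → ℂ) (c : Cfg L) : PiPole L (swap23 L F) c = PiPole L F (c.2, c.1) := by
  rw [PiPole_eq L hL, PiPole_eq L hL, ip_pw_swap23, ip_pw_swap23, ip_pw_swap23]
  ring

/-- **`G_T` commutes with `swap23`** (`T < 2ε₁`, `L ≥ 4`). [folklore] -/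
theorem Gapply_swap23 (hL : 4 ≤ L) {T : ℝ} (hT : T < 2 * eps1 L) (F : Cfg L → ℂ) (c : Cfg L) :
    Gapply L T (swap23 L F) c = Gapply L T F (c.2, c.1) := by
  have hL2 : 2 ≤ L := by omega
  have key := eq_zero_of_H0E_of_PiPole L hL hT
    (fun d => Gapply L T (swap23 L F) d - Gapply L T F (d.2, d.1)) ?_ ?_ c
  · exact sub_eq_zero.mp key
  · intro d
    have e1 := H0E_Gapply L hL hT (swap23 L F) d
    have e2 := H0E_Gapply L hL hT F (d.2, d.1)
    have e3 : H0apply L (K1 L) (fun c => Gapply L T F (c.2, c.1)) d = H0apply L (K1 L) (Gapply L T F) (d.2, d.1) :=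
      H0apply_swap23 L (K1 L) (Gapply L T F) d
    rw [PiPole_swap23 L hL2] at e1
    rw [H0apply_sub, e3]
    simp only [swap23] at e1 ⊢
    linear_combination e1 - e2
  · intro d
    rw [PiPole_sub, PiPole_Gapply L hL2,
      show (fun c : Cfg L => Gapply L T F (c.2, c.1)) = swap23 L (Gapply L T F) from rfl,
      PiPole_swap23 L hL2, PiPole_Gapply L hL2, sub_zero]

/-! ## `U12` -/

/-- `⟨1, U₁₂F⟩ = ⟨e^{iK₁·a}, F⟩`. [folklore] -/
theorem ip_pw00_U12 (F : Cfg L → ℂ) : ip L (pw L 0 0) (U12 L (K1 L) F) = ip L (pw L (K1 L) 0) F := by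
  unfold ip U12
  simp only [pw_pole₀, pw_pole₁, map_one, one_mul]
  calc ∑ c : Cfg L, phase L (K1 L) c.1 * F (-c.1, c.2 - c.1)
      = ∑ c : Cfg L, phase L (K1 L) c.1 * F (u12Map L c) := rfl
    _ = ∑ c : Cfg L, phase L (K1 L) (u12Map L c).1 * F (u12Map L (u12Map L c)) := by
        rw [← Equiv.sum_comp (u12Map_involutive L).toPerm]; rfl
    _ = ∑ c : Cfg L, (starRingEnd ℂ) (phase L (K1 L) c.1) * F c := by
        refine Finset.sum_congr rfl fun c _ => ?_
        rw [u12Map_involutive L c, conj_phase]; rfl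

/-- `⟨e^{iK₁·a}, U₁₂F⟩ = ⟨1, F⟩`. [folklore] -/
theorem ip_pw10_U12 (F : Cfg L → ℂ) : ip L (pw L (K1 L) 0) (U12 L (K1 L) F) = ip L (pw L 0 0) F := by
  unfold ip U12
  simp only [pw_pole₀, pw_pole₁, map_one, one_mul]
  calc ∑ c : Cfg L, (starRingEnd ℂ) (phase L (K1 L) c.1) * (phase L (K1 L) c.1 * F (-c.1, c.2 - c.1))
      = ∑ c : Cfg L, F (u12Map L c) := by
        refine Finset.sum_congr rfl fun c _ => ?_
        rw [conj_phase, ← mul_assoc, mul_comm (phase L (K1 L) (-c.1)), phase_mul_neg, one_mul]; rfl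
    _ = ∑ c : Cfg L, F (u12Map L (u12Map L c)) := by
        rw [← Equiv.sum_comp (u12Map_involutive L).toPerm]; rfl
    _ = ∑ c : Cfg L, F c := by
        refine Finset.sum_congr rfl fun c _ => ?_; rw [u12Map_involutive L c]

/-- `⟨e^{iK₁·b}, U₁₂F⟩ = ⟨e^{iK₁·b}, F⟩`. [folklore] -/
theorem ip_pw01_U12 (F : Cfg L → ℂ) : ip L (pw L 0 (K1 L)) (U12 L (K1 L) F) = ip L (pw L 0 (K1 L)) F := by
  unfold ip U12
  simp only [pw_pole₂]
  calc ∑ c : Cfg L, (starRingEnd ℂ) (phase L (K1 L) c.2) * (phase L (K1 L) c.1 * F (-c.1, c.2 - c.1))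
      = ∑ c : Cfg L, (starRingEnd ℂ) (phase L (K1 L) c.2) * (phase L (K1 L) c.1 * F (u12Map L c)) := rfl
    _ = ∑ c : Cfg L, (starRingEnd ℂ) (phase L (K1 L) (u12Map L c).2)
          * (phase L (K1 L) (u12Map L c).1 * F (u12Map L (u12Map L c))) := by
        rw [← Equiv.sum_comp (u12Map_involutive L).toPerm]; rfl
    _ = ∑ c : Cfg L, (starRingEnd ℂ) (phase L (K1 L) c.2) * F c := by
        refine Finset.sum_congr rfl fun c _ => ?_
        rw [u12Map_involutive L c]
        unfold u12Map
        simp only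
        rw [conj_phase, conj_phase, ← mul_assoc, ← phase_add]
        congr 2; abel

/-- **`Π` commutes with `U₁₂`.** [folklore] -/
theorem PiPole_U12 (hL : 2 ≤ L) (F : Cfg L → ℂ) (c : Cfg L) :
    PiPole L (U12 L (K1 L) F) c = U12 L (K1 L) (PiPole L F) c := by
  rw [PiPole_eq L hL (U12 L (K1 L) F) c, ip_pw00_U12, ip_pw10_U12, ip_pw01_U12]
  unfold U12
  rw [PiPole_eq L hL]
  have h1 : phase L (K1 L) c.1 * phase L (K1 L) (-c.1) = 1 := phase_mul_neg L (K1 L) c.1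
  have h2 : phase L (K1 L) c.1 * phase L (K1 L) (c.2 - c.1) = phase L (K1 L) c.2 := by
    rw [← phase_add]; congr 1; abel
  linear_combination (-(1 / ((L : ℂ) ^ 2) ^ 2) * ip L (pw L (K1 L) 0) F) * h1
    + (-(1 / ((L : ℂ) ^ 2) ^ 2) * ip L (pw L 0 (K1 L)) F) * h2

/-- **`G_T` commutes with `U₁₂`** (`T < 2ε₁`, `L ≥ 4`). [folklore] -/
theorem Gapply_U12 (hL : 4 ≤ L) {T : ℝ} (hT : T < 2 * eps1 L) (F : Cfg L → ℂ) (c : Cfg L) :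
    Gapply L T (U12 L (K1 L) F) c = U12 L (K1 L) (Gapply L T F) c := by
  have hL2 : 2 ≤ L := by omega
  have key := eq_zero_of_H0E_of_PiPole L hL hT
    (fun d => Gapply L T (U12 L (K1 L) F) d - U12 L (K1 L) (Gapply L T F) d) ?_ ?_ c
  · exact sub_eq_zero.mp key
  · intro d
    have e1 := H0E_Gapply L hL hT (U12 L (K1 L) F) d
    have e2 := H0E_Gapply L hL hT F (-d.1, d.2 - d.1)
    have e3 := H0apply_U12 L (K1 L) (Gapply L T F) d
    rw [PiPole_U12 L hL2] at e1
    rw [H0apply_sub, e3]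
    unfold U12 at e1 ⊢
    linear_combination e1 - phase L (K1 L) d.1 * e2
  · intro d
    rw [PiPole_sub, PiPole_Gapply L hL2, PiPole_U12 L hL2]
    unfold U12
    rw [PiPole_Gapply L hL2, mul_zero, sub_zero]

end Summit.HubbardSuperconductivity.HubbardSuperconductivity.Theorems.AnisotropyChord.Transfer.Fibre3

end
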